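import Mathlib
import Literature.Analysis.FluidPDE.NSGalerkinTrajectory
import Summits.AnomalousDissipation.AnomalousDissipation.Theorems.WazewskiBlockUniformWorkFloorTrapStressThreshold
import HarnessLib

/-!
# Stub `stub_workLipschitz` of the line `SketchIdeator5`
# (crux `WazewskiBlock.UniformGalerkinTrap`, stmt-AnomalousDissipation-10352)

Sorry-free discharge of the registered field-level stub `stub_workLipschitz` of the lead's skeleton:
along a global Galerkin trajectory `U` of order `N ≥ m` (`Torus.IsGalerkinTrajectory ν f N U`) driven
by a Galerkin-mode force `f` of order `m`, with `ν ≥ 0`, energy `kineticEnergy (U τ) ≤ E` on `[0, ∞)`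
and a strain bound `|⟪w, Df(x) w⟫| ≤ D ‖w‖²` (`D ≥ 0`), the work `W(t) = ∫⟪f, U t⟫` is Lipschitz in time,
`|W t − W s| ≤ (‖f‖₂² + ν (2E)^{1/2} ‖Δf‖₂ + 2 D E) |t − s|` for `s, t ≥ 0`.

**Proof.** The work identity `W(t) − W(s) = ∫ₛᵗ r(τ) dτ`
(`UniformWorkFloorTrap.Sketch.work_sub_work_eq_integral_workRate`, the tested Galerkin identity with
`a := f`) with the rate `r(τ) = ∫⟪U τ,(U τ·∇)f⟫ + ν ∫⟪U τ, Δf⟫ + ∫‖f‖²`, and the pointwise bound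
`|r(τ)| ≤ L` for `τ ≥ 0` (`abs_workRate_le`: the stress term by `|∫⟪V,(V·∇)f⟫| ≤ D∫‖V‖² = 2D KE(V) ≤ 2DE`,
the viscous term by Cauchy–Schwarz `|∫⟪V, Δf⟫| ≤ (2KE)^{1/2}‖Δf‖₂`, the constant term is its own bound);
then `‖∫ₛᵗ r‖ ≤ L |t − s|` (`intervalIntegral.norm_integral_le_of_norm_le_const`), and the case `t ≤ s`
by symmetry. [folklore]
-/

noncomputable section

-- `Summit.<Summit>.<Problem>` is the mandated summit-side namespace (CONVENTIONS §2); deliberate duplicate.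
set_option linter.dupNamespace false

namespace Summit.AnomalousDissipation.AnomalousDissipation.Theorems.UniformGalerkinTrap.Mane

open scoped InnerProductSpace ENNReal NNReal
open MeasureTheory Set Filter Topology
open Literature.Analysis.FunctionSpaces Literature.Analysis.FunctionSpaces.Torus
open Literature.Analysis.FluidPDE
open Summit.AnomalousDissipation.AnomalousDissipation.Theorems.UniformWorkFloorTrap.Sketch
  (work_sub_work_eq_integral_workRate)

/-- **Pointwise bound of the work rate on the energy ball.** For a smooth force `f`, `ν ≥ 0`, `D ≥ 0`
with `|⟪w, Df(x) w⟫| ≤ D‖w‖²`, and a smooth field `V` with `kineticEnergy V ≤ E`: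
`|∫⟪V,(V·∇)f⟫ + ν∫⟪V,Δf⟫ + ∫‖f‖²| ≤ ‖f‖₂² + ν (2E)^{1/2} ‖Δf‖₂ + 2 D E`
(stress term `≤ D∫‖V‖² = 2D KE(V)`, viscous term by Cauchy–Schwarz, constant term nonnegative). [folklore] -/
theorem abs_workRate_le {ν E D : ℝ} {f V : UnitAddTorus (Fin 3) → EuclideanSpace ℝ (Fin 3)}
    (hf : IsSmooth f) (hν : 0 ≤ ν) (hD : 0 ≤ D) (hVs : IsSmooth V) (hKE : kineticEnergy V ≤ E)
    (hstrain : ∀ (x : UnitAddTorus (Fin 3)) (w : EuclideanSpace ℝ (Fin 3)),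
      |⟪w, convect (fun _ => w) f x⟫_ℝ| ≤ D * ‖w‖ ^ 2) :
    |(∫ x, ⟪V x, convect V f x⟫_ℝ) + ν * (∫ x, ⟪V x, laplacian f x⟫_ℝ) + ∫ x, ‖f x‖ ^ 2| ≤
      (∫ x, ‖f x‖ ^ 2) + ν * Real.sqrt (2 * E) * Real.sqrt (∫ x, ‖laplacian f x‖ ^ 2) +
        2 * D * E := by
  have hKE2 : ∫ x, ‖V x‖ ^ 2 = 2 * kineticEnergy V := by simp only [kineticEnergy]; ring
  -- stress term: `|∫⟪V,(V·∇)f⟫| ≤ D ∫‖V‖² = 2 D KE(V) ≤ 2 D E`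
  have hA : |∫ x, ⟪V x, convect V f x⟫_ℝ| ≤ 2 * D * E := by
    have h1 : ‖∫ x, ⟪V x, convect V f x⟫_ℝ‖ ≤ ∫ x, D * ‖V x‖ ^ 2 :=
      norm_integral_le_of_norm_le (hVs.norm_sq.integrable.const_mul D)
        (ae_of_all _ fun x => by rw [Real.norm_eq_abs]; exact hstrain x (V x))
    rw [Real.norm_eq_abs, integral_const_mul, hKE2] at h1
    have h2 : D * (2 * kineticEnergy V) ≤ D * (2 * E) := by gcongr
    linarith
  -- viscous term: `|∫⟪V,Δf⟫| ≤ (2 KE)^{1/2} ‖Δf‖₂ ≤ (2E)^{1/2} ‖Δf‖₂`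
  have hB : |ν * ∫ x, ⟪V x, laplacian f x⟫_ℝ| ≤
      ν * Real.sqrt (2 * E) * Real.sqrt (∫ x, ‖laplacian f x‖ ^ 2) := by
    have h := abs_integral_inner_le_sqrt_sq_mul_sqrt_sq (hVs.memLp 2) (hf.laplacian.memLp 2)
    have hBabs : |∫ x, ⟪V x, laplacian f x⟫_ℝ| ≤
        Real.sqrt (2 * E) * Real.sqrt (∫ x, ‖laplacian f x‖ ^ 2) := by
      refine h.trans (mul_le_mul_of_nonneg_right (Real.sqrt_le_sqrt ?_) (Real.sqrt_nonneg _))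
      rw [hKE2]; linarith
    rw [abs_mul, abs_of_nonneg hν, mul_assoc]
    exact mul_le_mul_of_nonneg_left hBabs hν
  -- constant term
  have hC : |∫ x, ‖f x‖ ^ 2| = ∫ x, ‖f x‖ ^ 2 := abs_of_nonneg (integral_nonneg fun _ => sq_nonneg _)
  calc |(∫ x, ⟪V x, convect V f x⟫_ℝ) + ν * (∫ x, ⟪V x, laplacian f x⟫_ℝ) + ∫ x, ‖f x‖ ^ 2|
      ≤ |∫ x, ⟪V x, convect V f x⟫_ℝ| + |ν * ∫ x, ⟪V x, laplacian f x⟫_ℝ| + |∫ x, ‖f x‖ ^ 2| :=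
        (abs_add_le _ _).trans (by gcongr; exact abs_add_le _ _)
    _ ≤ 2 * D * E + ν * Real.sqrt (2 * E) * Real.sqrt (∫ x, ‖laplacian f x‖ ^ 2) +
          ∫ x, ‖f x‖ ^ 2 := by rw [hC]; gcongr
    _ = _ := by ring

/-- **Time-Lipschitz injection.** Along a global Galerkin trajectory `U` of order `N ≥ m` driven by a Galerkin-mode
force `f` of order `m` (`ν ≥ 0`) whose energy stays `≤ E` on `[0,∞)`, if `D ≥ 0` bounds the strain of the force,
`|⟪w, Df(x) w⟫| ≤ D ‖w‖²`, then the work `W(t) = ∫⟪f, U t⟫` satisfies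
`|W t - W s| ≤ (‖f‖₂² + ν (2E)^{1/2} ‖Δf‖₂ + 2 D E) |t - s|` for `s, t ≥ 0`: the tested Galerkin identity with
`a := f` (`work_sub_work_eq_integral_workRate`) and the pointwise bound of the rate on the energy ball (stress
`|∫⟪U,(U·∇)f⟫| ≤ 2 D KE`, viscous term by Cauchy–Schwarz, `∫‖f‖²` constant). [folklore] -/
theorem stub_workLipschitz :
    ∀ (ν : ℝ) (m N : ℕ) (f : UnitAddTorus (Fin 3) → EuclideanSpace ℝ (Fin 3)) (E D : ℝ)
      (U : ℝ → UnitAddTorus (Fin 3) → EuclideanSpace ℝ (Fin 3)),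
      IsGalerkinMode m f → m ≤ N → 0 ≤ ν → 0 ≤ D → Torus.IsGalerkinTrajectory ν f N U →
      (∀ τ : ℝ, 0 ≤ τ → kineticEnergy (U τ) ≤ E) →
      (∀ (x : UnitAddTorus (Fin 3)) (w : EuclideanSpace ℝ (Fin 3)),
        |⟪w, convect (fun _ => w) f x⟫_ℝ| ≤ D * ‖w‖ ^ 2) →
      ∀ s t : ℝ, 0 ≤ s → 0 ≤ t →
        |(∫ x, ⟪f x, U t x⟫_ℝ) - ∫ x, ⟪f x, U s x⟫_ℝ| ≤
          ((∫ x, ‖f x‖ ^ 2) + ν * Real.sqrt (2 * E) * Real.sqrt (∫ x, ‖laplacian f x‖ ^ 2) + 2 * D * E) *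
            |t - s| := by
  intro ν m N f E D U hf hmN hν hD hU hKE hstrain
  -- the case `s ≤ t`: work identity and the pointwise bound of the rate on `Ι s t ⊆ (0, ∞)`
  have key : ∀ s t : ℝ, 0 ≤ s → s ≤ t →
      |(∫ x, ⟪f x, U t x⟫_ℝ) - ∫ x, ⟪f x, U s x⟫_ℝ| ≤
        ((∫ x, ‖f x‖ ^ 2) + ν * Real.sqrt (2 * E) * Real.sqrt (∫ x, ‖laplacian f x‖ ^ 2) +
          2 * D * E) * |t - s| := by
    intro s t hs hst
    rw [work_sub_work_eq_integral_workRate hf hmN hU hs hst, ← Real.norm_eq_abs]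
    refine intervalIntegral.norm_integral_le_of_norm_le_const fun τ hτ => ?_
    have hτ0 : 0 ≤ τ := by
      rcases Set.mem_uIoc.1 hτ with h | h
      · exact hs.trans h.1.le
      · exact (hs.trans hst).trans h.1.le
    rw [Real.norm_eq_abs]
    exact abs_workRate_le hf.isSmooth hν hD (hU.isSmooth hτ0) (hKE τ hτ0) hstrain
  intro s t hs ht
  rcases le_total s t with hst | hts
  · exact key s t hs hst
  · have h := key t s ht hts
    rwa [abs_sub_comm (∫ x, ⟪f x, U s x⟫_ℝ), abs_sub_comm s t] at h

end Summit.AnomalousDissipation.AnomalousDissipation.Theorems.UniformGalerkinTrap.Mane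

end
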